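import Summits.CriticalPhenomena.PercolationContinuityZ3.Theorems.Transplant.CayleyScaledHeisenberg
import Mathlib.GroupTheory.Index
import HarnessLib

/-!
# SCOPE RECORD for the covering route: the FC hypothesis of «AutEndStateFC» FAILS for the Heisenberg DATUM (`H₃(ℤ)` by left translations, `c` = abelianisation;
# likewise every finite-index `Γ₀ ≤ H₃(ℤ)`) — every element off the kernel of the abelianisation has a centraliser of INFINITE index — so
# `AutCyl.conj4_of_orbitDatum_fc` and the growth-degree route are INCOMPARABLE sufficient conditions

builds on p205010 (kernel theorem, internal audit signed; external expert review pending) — nothing in this file uses p205010; pure group theory, no percolation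
statement.  Lane `prim-bschramm`, seat `prim-bschramm-p3` gen 32 (DESIGN OWNER; RULING L-Q3-2 / W-2: 'the residual side — a located record of what the covering
route does NOT cover').  Helper file (`--supports stmt-CriticalPhenomena-4575 --as helper`).  Def-free.

THE RECORD.  «AutEndStateFC» `AutCyl.conj4_of_orbitDatum_fc` (p567166) gives `θ(p_c) = 0` for an orbit datum `(A₀, c)` carrying an element `g` with `c g ≠ 1` that
commutes with a finite-index subgroup of `A₀` (FC-split data).  For the HEISENBERG datum — `H₃(ℤ)` acting on its own Cayley graphs, `c` = the abelianisation `φ` of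
«CayleyScaledHeisenberg» — there is NO such element: `h` commutes with `g` iff `h.x · g.y = g.x · h.y` (`commute_iff`), so for `φ g ≠ 0` the elements `(0, n, 0)` (or
`(n, 0, 0)`) lie in pairwise distinct cosets of every subgroup commuting with `g` (`index_eq_zero_of_commuting`: index `0` = infinite), and NO finite-index subgroup
commutes with `g` (`not_finiteIndex_of_commuting`).  Hence the Heisenberg DATUM — the polynomial route's `H₃(ℤ)` input (rung Q + Wolf, «AutCylinderWolf») — is OUTSIDE
the FC hypothesis of `AutCyl.conj4_of_orbitDatum_fc`, while `K × ℤ²` with `K` of intermediate growth (central `ℤ²`: FC-split, «AutEndStateFCCayley»/«…VFC») is outside the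
polynomial route — the two sufficient conditions for the end state now in the tree are incomparable; their common residual (twisted data of intermediate growth) is
`P3-NILPOTENT.md` §25.3–25.4.  (The GRAPH-level sentence 'every orbit datum on every Cayley graph of `H₃(ℤ)` fails FC' holds modulo Trofimov's theorem, by the same
commutator argument after descending the datum to the discrete quotient of `Aut` — NOT typed here; refuter's item W-Scope-1.)
[cite: BenjaminiSchramm1996, §2 (Cayley graphs)] [cite: MartineauSevero2019, §3 Remark 2]
-/

namespace Summit.CriticalPhenomena.PercolationContinuityZ3.Theorems.Transplant

namespace Heis3

/-- **Commutation in `H₃(ℤ)`**: `h g = g h ⟺ h.x · g.y = g.x · h.y` (the `z`-coordinates of the two products differ by the symplectic form of the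
abelianisations). [folklore] -/
theorem commute_iff (g h : Heis3) : h * g = g * h ↔ h.x * g.y = g.x * h.y := by
  constructor
  · intro hc
    have hz := congrArg Heis3.z hc
    simp only [mul_z] at hz
    linarith
  · intro hxy
    ext <;> simp <;> linarith

/-- **A subgroup commuting with an element off the centre's preimage has index `0` (= infinite index)**: if every `n ∈ N` commutes with `g` and `φ g ≠ 0`
then the elements `(0, n, 0)` (`g.x ≠ 0`) resp. `(n, 0, 0)` (`g.y ≠ 0`), `n ∈ ℤ`, lie in pairwise distinct left cosets of `N`. [folklore] -/
theorem index_eq_zero_of_commuting (g : Heis3) (hg : φ g ≠ 0) (N : Subgroup Heis3) (hN : ∀ n ∈ N, n * g = g * n) : N.index = 0 := by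
  rw [Subgroup.index_eq_zero_iff_infinite]
  -- a coordinate of `g` that does not vanish
  have hxy : g.x ≠ 0 ∨ g.y ≠ 0 := by
    by_contra h
    rw [not_or, not_not, not_not] at h
    apply hg
    funext i
    fin_cases i
    · exact h.1
    · exact h.2
  -- the one-parameter family transverse to the centraliser
  let f : ℤ → Heis3 := fun n => if g.x ≠ 0 then ⟨0, n, 0⟩ else ⟨n, 0, 0⟩
  have hf : ∀ n m : ℤ, (f n)⁻¹ * f m ∈ N → n = m := by
    intro n m hnm
    have hc := (commute_iff g _).1 (hN _ hnm)
    by_cases hx : g.x ≠ 0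
    · simp only [f, if_pos hx, inv_x, inv_y, mul_x, mul_y, neg_zero, zero_add, zero_mul] at hc
      -- `0 = g.x * (-n + m)`
      have : -n + m = 0 := by
        rcases mul_eq_zero.1 hc.symm with h | h
        · exact absurd h hx
        · exact h
      linarith
    · have hy : g.y ≠ 0 := hxy.resolve_left hx
      simp only [f, if_neg hx, inv_x, inv_y, mul_x, mul_y, neg_zero, zero_add, mul_zero] at hc
      -- `(-n + m) * g.y = 0`
      have : -n + m = 0 := by
        rcases mul_eq_zero.1 hc with h | h
        · exact h
        · exact absurd h hy
      linarith
  refine Infinite.of_injective (fun n : ℤ => (QuotientGroup.mk (f n) : Heis3 ⧸ N)) fun n m hnm => ?_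
  exact hf n m (QuotientGroup.eq.1 hnm)

/-- **No finite-index subgroup of `H₃(ℤ)` commutes with an element off the kernel of the abelianisation** — the FC hypothesis of
`AutCyl.conj4_of_orbitDatum_fc` fails for the Heisenberg datum (which the polynomial route covers instead). [folklore] -/
theorem not_finiteIndex_of_commuting (g : Heis3) (hg : φ g ≠ 0) (N : Subgroup Heis3) (hN : ∀ n ∈ N, n * g = g * n) : ¬ N.FiniteIndex := by
  rw [Subgroup.not_finiteIndex_iff]
  exact index_eq_zero_of_commuting g hg N hN

/-- **In particular the centraliser of such an element has infinite index** (`H₃(ℤ)` has no FC element off the centre's preimage). [folklore] -/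
theorem index_centralizer_eq_zero (g : Heis3) (hg : φ g ≠ 0) : (Subgroup.centralizer ({g} : Set Heis3)).index = 0 :=
  index_eq_zero_of_commuting g hg _ fun n hn => by
    have h := Subgroup.mem_centralizer_iff.1 hn g (Set.mem_singleton g)
    exact h.symm

end Heis3

end Summit.CriticalPhenomena.PercolationContinuityZ3.Theorems.Transplant
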